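import Summits.QuantumAdvantage.QuantumAdvantage.Theorems.LinnikCubicClassGroupsDegreeOnePrimesEscapeClassPNTDHThetaPointed
import Summits.QuantumAdvantage.QuantumAdvantage.Theorems.LinnikCubicClassGroupsDegreeOnePrimesEscapeLeastPrimeIdeal
import HarnessLib

/-!
# The class prime number theorem with RELATIVE error, POINTED at a given exceptional zero

Topic `Summits/QuantumAdvantage/QuantumAdvantage/Theorems`, cell B2b-1 (linnik-cubic), PART A (gen 7);
helper toward the crux `DegreeOnePrimesEscape` (stmt-QuantumAdvantage-11543) of route
`LinnikCubicClassGroups`.  HONEST FRAMING: the value of this file is a THEOREM (kernel-checked, GRH-free,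
no hypothesis) — NOT summit progress.

* `thetaClass_relative_pointed` — the pointed form of `thetaClass_relative` (`…LeastPrimeIdeal.lean`): for
  `n > 1`, `ε > 0` there are `a₂ ≥ 1`, `c > 0` such that for every number field `K` of degree `n` and every
  zero `(ψ₁, ρ₁)` of `ζ_K ∏_{χ ≠ 1} L(s, χ)` on the segment `Im ρ = 0`, `1 − c/(log|d_K| + log 4) < Re ρ < 1`:
  `χ₁ = ψ₁` is real, `β₁ = Re ρ₁` is a zero of `L(s, χ₁)`, and with `M_C(x) = x − χ₁(C) x^{β₁}/β₁ > 0`,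
  `|θ_C(x) − M_C(x)/h_K| ≤ ε M_C(x)/h_K` for all `x ≥ Q^{a₂}` and all classes `C`.  Unconditional
  (`deuringHeilbronn`).
* `chebyshevThetaIdeal_relative_at_realZero` — the case `χ₁ = 1`, summed over the classes: if `ζ_K` has a
  real zero `β ∈ (1 − c/(log|d_K| + log 4), 1)` then `|θ_K(x) − (x − x^β/β)| ≤ ε (x − x^β/β)` for
  `x ≥ Q^{a₂}`.  This is the form in which the exceptional zero of a SUBFIELD (inherited by `ζ_K`) is fed in.

References: J. Thorner, A. Zaman, Algebra Number Theory 13 (2019), Thm. 1.4 [ThornerZaman2019];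
A. Weiss, J. reine angew. Math. 338 (1983), Thm. 5.2 [Weiss1983].
-/

noncomputable section

open Complex Real MeasureTheory Set Filter Topology
open scoped NumberField nonZeroDivisors

namespace Summit.QuantumAdvantage.QuantumAdvantage.Theorems.DegreeOnePrimesEscape

open Literature.NumberTheory.LFunctions Literature.NumberTheory.LFunctions.NumberField
  Literature.NumberTheory.LFunctions.AbelianDensity

set_option maxHeartbeats 800000 in
/-- **The class prime number theorem with relative error, pointed at a given exceptional zero**
(unconditional; see the module docstring). [cite: ThornerZaman2019, Theorem 1.4] [cite: Weiss1983, Theorem 5.2] -/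
theorem thetaClass_relative_pointed (n : ℕ) (hn : 1 < n) {ε : ℝ} (hε : 0 < ε) :
    ∃ a₂ c : ℝ, 1 ≤ a₂ ∧ 0 < c ∧ c ≤ 1 / (8 * ((n : ℝ) ^ 2 + 1)) ∧
    ∀ (K : Type) [Field K] [NumberField K], Module.finrank ℚ K = n →
      ∀ (ψ₁ : AddChar (Additive (ClassGroup (𝓞 K))) ℂ) (ρ₁ : ℂ), famF K ψ₁ ρ₁ = 0 → 0 < ρ₁.re →
        ρ₁.re < 1 → excRegion c K ρ₁ →
        (toMulHom ψ₁).toHomUnits * (toMulHom ψ₁).toHomUnits = 1 ∧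
          classGroupLFunction K (toMulHom ψ₁).toHomUnits ρ₁.re = 0 ∧
          ∀ x : ℝ, ThornerZaman.condQn K ^ a₂ ≤ x → ∀ C : ClassGroup (𝓞 K),
            0 < x - (((toMulHom ψ₁).toHomUnits C : ℂ)).re * x ^ ρ₁.re / ρ₁.re ∧
            |chebyshevThetaIdealClass K C x -
                (x - (((toMulHom ψ₁).toHomUnits C : ℂ)).re * x ^ ρ₁.re / ρ₁.re) /
                  NumberField.classNumber K| ≤
              ε * (x - (((toMulHom ψ₁).toHomUnits C : ℂ)).re * x ^ ρ₁.re / ρ₁.re) /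
                NumberField.classNumber K := by
  classical
  obtain ⟨A, -, hA⟩ := Residue.residueLowerBound_all n
  obtain ⟨b, D, hb, hD, hdens⟩ := fam_density_local n hn A
  have ha : (1 : ℝ) ≤ max A 4 := le_trans (by norm_num) (le_max_right _ _)
  have hε4 : 0 < ε / 4 := by positivity
  obtain ⟨a₂, c, ha₂1, hc, hcn, hθ⟩ := thetaClass_pointed_dh n hn hb hD ha hε4 deuringHeilbronn
  have hn2 : (2 : ℝ) ≤ n := by exact_mod_cast hn
  refine ⟨max a₂ 16, c, le_trans ha₂1 (le_max_left _ _), hc, hcn, fun K _ _ hKn ↦ ?_⟩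
  have hK : 1 < Module.finrank ℚ K := by rw [hKn]; exact hn
  set Q : ℝ := ThornerZaman.condQn K with hQ
  have hQ12 : (12 : ℝ) ≤ Q := ThornerZaman.twelve_le_condQn (K := K) hK
  have hQ1 : (1 : ℝ) < Q := by linarith
  have hlogQ : 2 ≤ Real.log Q := two_lt_log_twelve.le.trans (Real.log_le_log (by norm_num) hQ12)
  set h : ℝ := (NumberField.classNumber K : ℝ) with hh
  have hh1 : 1 ≤ h := by rw [hh]; exact_mod_cast one_le_classNumber (K := K)
  have hh0 : 0 < h := by linarith
  have hsz : ∀ x : ℝ, Q ^ max a₂ 16 ≤ x → Q ^ a₂ ≤ x ∧ 1 < x ∧ 16 ≤ Real.log x := by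
    intro x hx
    have hxa₂ : Q ^ a₂ ≤ x := le_trans (Real.rpow_le_rpow_of_exponent_le hQ1.le (le_max_left _ _)) hx
    have hxQ : Q ≤ x := by
      have : Q ^ (1 : ℝ) ≤ Q ^ a₂ := Real.rpow_le_rpow_of_exponent_le hQ1.le ha₂1
      rw [Real.rpow_one] at this; linarith
    have hLQ : max a₂ 16 * Real.log Q ≤ Real.log x := by
      have := Real.log_le_log (by positivity) hx
      rwa [Real.log_rpow (by linarith)] at this
    have h16 : (16 : ℝ) ≤ max a₂ 16 := le_max_right _ _
    exact ⟨hxa₂, by linarith, by nlinarith⟩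
  intro ψ₁ ρ₁ hz0 hre₁ hre₁' hexc₁
  obtain ⟨hreal, hLz, hexc⟩ := hθ K hKn (hdens K hKn (hA K hKn)) ψ₁ ρ₁ hz0 hre₁ hre₁' hexc₁
  set χ₁ : ClassGroup (𝓞 K) →* ℂˣ := (toMulHom ψ₁).toHomUnits with hχ₁
  set β₁ : ℝ := ρ₁.re with hβ₁
  have hβ1 : β₁ < 1 := hre₁'
  have hβlow : 1 - c / (Real.log ((NumberField.discr K).natAbs : ℝ) + Real.log 4) < β₁ := hexc₁.2
  -- `β₁ ≥ 3/4`
  have hβ34 : 3 / 4 ≤ β₁ := by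
    have hlog4 : 1 < Real.log 4 := by
      rw [show (4:ℝ) = 2 ^ 2 by norm_num, Real.log_pow]; have := Real.log_two_gt_d9; push_cast; linarith
    have hlogd : 0 ≤ Real.log ((NumberField.discr K).natAbs : ℝ) := Real.log_natCast_nonneg _
    have hc4 : c ≤ 1 / 4 :=
      hcn.trans (by rw [div_le_div_iff_of_pos_left one_pos (by positivity) (by norm_num)]; nlinarith)
    have : c / (Real.log ((NumberField.discr K).natAbs : ℝ) + Real.log 4) ≤ 1 / 4 := by
      rw [div_le_iff₀ (by linarith)]; nlinarith
    linarith
  refine ⟨hreal, hLz, fun x hx C ↦ ?_⟩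
  obtain ⟨hxa₂, hx1, hL16⟩ := hsz x hx
  have hx0 : 0 < x := by linarith
  have hb := hexc x hxa₂ C
  have hr := abs_re_classGroupChar_apply_le hreal C
  have hM := sub_mul_rpow_div_ge hx1 hL16 hβ34 hβ1 hr
  have hm0 : 0 < min 1 ((1 - β₁) * Real.log x) := lt_min one_pos (mul_pos (by linarith) (by linarith))
  have hM0 : 0 < x - ((χ₁ C : ℂ)).re * x ^ β₁ / β₁ := lt_of_lt_of_le (by positivity) hM
  refine ⟨hM0, hb.trans ?_⟩
  rw [div_le_div_iff_of_pos_right hh0]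
  nlinarith

/-- **The prime ideal theorem with relative error at a known real zero of `ζ_K`** (the case `χ₁ = 1`
of `thetaClass_relative_pointed`, summed over the classes): for `n > 1`, `ε > 0` there are `a₂ ≥ 1`,
`c > 0` such that for every number field `K` of degree `n` and every real zero `β` of `ζ_K` with
`1 − c/(log|d_K| + log 4) < β < 1`, for all `x ≥ Q^{a₂}`: `x − x^β/β > 0` and
`|θ_K(x) − (x − x^β/β)| ≤ ε (x − x^β/β)`.  Unconditional. [cite: ThornerZaman2019, Theorem 1.4] -/
theorem chebyshevThetaIdeal_relative_at_realZero (n : ℕ) (hn : 1 < n) {ε : ℝ} (hε : 0 < ε) :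
    ∃ a₂ c : ℝ, 1 ≤ a₂ ∧ 0 < c ∧
    ∀ (K : Type) [Field K] [NumberField K], Module.finrank ℚ K = n →
      ∀ β : ℝ, dedekindZeta₁ K β = 0 → 0 < β → β < 1 →
        1 - c / (Real.log ((NumberField.discr K).natAbs : ℝ) + Real.log 4) < β →
        ∀ x : ℝ, ThornerZaman.condQn K ^ a₂ ≤ x →
          0 < x - x ^ β / β ∧ |chebyshevThetaIdeal K x - (x - x ^ β / β)| ≤ ε * (x - x ^ β / β) := by
  classical
  obtain ⟨a₂, c, ha₂, hc, -, h⟩ := thetaClass_relative_pointed n hn hε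
  refine ⟨a₂, c, ha₂, hc, fun K _ _ hKn β hz hβ0 hβ1 hβc x hx ↦ ?_⟩
  have hfam : famF K 0 (β : ℂ) = 0 := by rw [famF_zero]; exact hz
  have hexc : excRegion c K (β : ℂ) := ⟨Complex.ofReal_im β, by rw [Complex.ofReal_re]; exact hβc⟩
  obtain ⟨-, -, hC⟩ := h K hKn 0 (β : ℂ) hfam (by rw [Complex.ofReal_re]; exact hβ0)
    (by rw [Complex.ofReal_re]; exact hβ1) hexc
  simp only [Complex.ofReal_re, toHomUnits_toMulHom_zero, MonoidHom.one_apply, Units.val_one,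
    Complex.one_re, one_mul] at hC
  set h : ℝ := (NumberField.classNumber K : ℝ) with hh
  have hh1 : 1 ≤ h := by rw [hh]; exact_mod_cast one_le_classNumber (K := K)
  have hh0 : 0 < h := by linarith
  have hcard : (Fintype.card (ClassGroup (𝓞 K)) : ℝ) = h := by
    rw [hh, show NumberField.classNumber K = Fintype.card (ClassGroup (𝓞 K)) from rfl]
  have hC1 := hC x hx
  refine ⟨(hC1 1).1, ?_⟩
  set M : ℝ := x - x ^ β / β with hM
  rw [← sum_chebyshevThetaIdealClass K x]
  have hbound : ∀ C : ClassGroup (𝓞 K), |chebyshevThetaIdealClass K C x - M / h| ≤ ε * M / h :=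
    fun C ↦ (hC1 C).2
  have hsumM : ∑ _C : ClassGroup (𝓞 K), M / h = M := by
    rw [Finset.sum_const, Finset.card_univ, nsmul_eq_mul, hcard]; field_simp
  have hsumE : ∑ _C : ClassGroup (𝓞 K), ε * M / h = ε * M := by
    rw [Finset.sum_const, Finset.card_univ, nsmul_eq_mul, hcard]; field_simp
  calc |∑ C, chebyshevThetaIdealClass K C x - M|
      = |∑ C : ClassGroup (𝓞 K), (chebyshevThetaIdealClass K C x - M / h)| := by
        rw [Finset.sum_sub_distrib, hsumM]
    _ ≤ ∑ C : ClassGroup (𝓞 K), |chebyshevThetaIdealClass K C x - M / h| := Finset.abs_sum_le_sum_abs _ _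
    _ ≤ ∑ _C : ClassGroup (𝓞 K), ε * M / h := Finset.sum_le_sum fun C _ ↦ hbound C
    _ = ε * M := hsumE

end Summit.QuantumAdvantage.QuantumAdvantage.Theorems.DegreeOnePrimesEscape

end
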